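import Literature.Analysis.Fourier.RadialSchwartzInterpolationCoefficients
import Literature.Analysis.Fourier.RadialSchwartzInterpolationFEImpliesIF
import HarnessLib

/-!
# CKMRV interpolation, step 9: Theorem 3.1 (functional equations ⇒ interpolation basis)

Sibling of `Literature/Analysis/Fourier/RadialSchwartzInterpolation.lean` (the named fact
`CKMRV2022_interpolationFormula` = Cohn–Kumar–Miller–Radchenko–Viazovska, Ann. Math. 196 (2022),
Theorem 1.7). This file proves **CKMRV Theorem 3.1** (the dimension-free reduction of Theorem 1.7
to the existence of generating functions), in the case `n₀ = 1`, by combining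

* step 8 (`exists_schwartz_coefficients`): a generating function `F : ℍ × ℝᵈ → ℂ` satisfying the
  hypotheses (1)–(4) of Theorem 3.1 and `(T − I)²`-annihilation has an expansion
  `F(τ,x) = ∑_{n≥1} aₙ(x) qⁿ + 2πiτ ∑_{n≥1} √(2n) bₙ(x) qⁿ` with radial Schwartz coefficients of
  polynomial growth (first half of the printed proof), and
* step 6 (`IsInterpolationBasis.of_functionalEquation`): families whose generating functions
  satisfy (1.8) are interpolation bases (second half of the printed proof),

into `isInterpolationBasis_of_generatingFunctions`: if `F` and `F̃` satisfy (1)–(4), are radial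
in `x`, are annihilated by `(T − I)²` and satisfy
`F(τ,x) + (i/τ)^{d/2} F̃(−1/τ,x) = e^{πiτ|x|²}`, then there is an interpolation basis
`(aₙ, bₙ, ãₙ, b̃ₙ)_{n ≥ 1}` of radial Schwartz functions on `ℝᵈ` (CKMRV Theorem 3.1 with `n₀ = 1`;
the hypotheses (3) are taken in Fréchet form, see `HasGrowthBounds`, and the conclusion is the
`IsInterpolationBasis` of the named fact).

Everything is proved; no named facts.

## References

* H. Cohn, A. Kumar, S. D. Miller, D. Radchenko, M. Viazovska, *Universal optimality of the `E₈`
  and Leech lattices and interpolation formulas*, Ann. of Math. 196 (2022) 983–1082,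
  arXiv:1902.05438: §3.1 Theorem 3.1. [CohnEtAl2019]
-/

noncomputable section

open scoped Topology UpperHalfPlane Manifold Real SchwartzMap ContDiff
open Filter Complex UpperHalfPlane Function MeasureTheory Set

namespace Literature.Analysis.Fourier

/-! ## The hypotheses of Theorem 3.1 on one generating function -/

/-- **The hypotheses (1)–(4) of CKMRV Theorem 3.1 on a generating function** `F : ℍ × P → ℂ`
(curried), together with the functional equation `F(τ+2,x) − 2F(τ+1,x) + F(τ,x) = 0` of (5):
smooth fibres `F(τ,·)` with jointly continuous `x`-derivatives ("smooth functions
`F : ℍ × ℝᵈ → ℂ`"), holomorphic sections `F(·,x)` (1), the bounds (3) in Fréchet form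
(`HasGrowthBounds`), and (4) `|F(τ,x)| ≤ α Im(τ)^{−β}`, `β > 0`, for `|Re τ| ≤ 1`. (Radiality (2)
is kept separate.) [cite: CohnEtAl2019, §3.1 Theorem 3.1] -/
structure IsGeneratingFamily {P : Type*} [NormedAddCommGroup P] [NormedSpace ℝ P]
    (F : ℍ → P → ℂ) : Prop where
  smooth : ∀ τ, ContDiff ℝ ∞ (F τ)
  cont : ∀ m : ℕ, Continuous fun q : ℍ × P => iteratedFDeriv ℝ m (F q.1) q.2
  hol : ∀ x, MDiff fun τ => F τ x
  shift_sq : ∀ τ x, F ((2 : ℝ) +ᵥ τ) x - 2 * F ((1 : ℝ) +ᵥ τ) x + F τ x = 0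
  growth : HasGrowthBounds F
  strip : ∃ α β : ℝ, 0 < β ∧ ∀ τ x, |τ.re| ≤ 1 → ‖F τ x‖ ≤ α * τ.im ^ (-β)

variable {d : ℕ}


/-! ## From the expansion `∑ aₙ qⁿ + τ ∑ gₙ qⁿ` to the generating function of `(aₙ, bₙ)` -/

/-- `q^{n+1} = e^{2πi(1+n)τ}` for `q = e^{2πiτ}`. [folklore] -/
theorem qParam_one_pow_succ (τ : ℂ) (n : ℕ) :
    Periodic.qParam 1 τ ^ (n + 1) = cexp (2 * π * Complex.I * ((1 : ℂ) + n) * τ) := by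
  rw [Periodic.qParam, ← Complex.exp_nat_mul]
  congr 1
  push_cast
  ring

/-- `2π i √(2(1+n)) ≠ 0`. [folklore] -/
theorem two_pi_I_node_ne_zero (n : ℕ) : (2 * π * Complex.I * (node 1 n : ℂ)) ≠ 0 := by
  have h : (node 1 n : ℂ) ≠ 0 := Complex.ofReal_ne_zero.2 (node_pos le_rfl n).ne'
  exact mul_ne_zero (mul_ne_zero (mul_ne_zero two_ne_zero (Complex.ofReal_ne_zero.2 Real.pi_ne_zero))
    Complex.I_ne_zero) h

/-- **`bₙ` from `gₙ`:** `bₙ = gₙ / (2πi √(2n))` (CKMRV (3.4): `F(τ+1) − F(τ) = 2πi ∑ √(2n) bₙ e^{2πinτ}`),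
as Schwartz functions (`n` stands for the index `n + 1`). [cite: CohnEtAl2019, §3.1 (3.4)] -/
def bOfG (g : ℕ → 𝓢(EuclideanSpace ℝ (Fin d), ℂ)) (n : ℕ) : 𝓢(EuclideanSpace ℝ (Fin d), ℂ) :=
  (2 * π * Complex.I * (node 1 n : ℂ))⁻¹ • g n

/-- Values of `bₙ`. [folklore] -/
@[simp]
theorem bOfG_apply (g : ℕ → 𝓢(EuclideanSpace ℝ (Fin d), ℂ)) (n : ℕ) (x : EuclideanSpace ℝ (Fin d)) :
    bOfG g n x = (2 * π * Complex.I * (node 1 n : ℂ))⁻¹ * g n x := rfl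

/-- `2πi √(2(1+n)) bₙ(x) = gₙ(x)`. [folklore] -/
theorem node_mul_bOfG (g : ℕ → 𝓢(EuclideanSpace ℝ (Fin d), ℂ)) (n : ℕ) (x : EuclideanSpace ℝ (Fin d)) :
    2 * π * Complex.I * ((node 1 n : ℂ) * bOfG g n x) = g n x := by
  rw [bOfG_apply, ← mul_assoc, mul_inv_cancel_left₀ (two_pi_I_node_ne_zero n)]

/-- `bₙ` is radial if `gₙ` is. [folklore] -/
theorem isRadial_bOfG {g : ℕ → 𝓢(EuclideanSpace ℝ (Fin d), ℂ)} (hg : ∀ n, IsRadial (g n)) (n : ℕ) :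
    IsRadial (bOfG g n) := by
  intro x y h
  simp only [bOfG_apply, hg n h]

/-- `‖bₙ(x)‖ ≤ ‖gₙ(x)‖` (the denominator `2π√(2(1+n))` is `≥ 1`). [folklore] -/
theorem norm_bOfG_le (g : ℕ → 𝓢(EuclideanSpace ℝ (Fin d), ℂ)) (n : ℕ) (x : EuclideanSpace ℝ (Fin d)) :
    ‖bOfG g n x‖ ≤ ‖g n x‖ := by
  rw [bOfG_apply, norm_mul, norm_inv]
  refine mul_le_of_le_one_left (norm_nonneg _) (inv_le_one_of_one_le₀ ?_)
  rw [norm_mul, norm_mul, norm_mul, Complex.norm_ofNat, Complex.norm_real, Complex.norm_I,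
    Complex.norm_real, Real.norm_of_nonneg Real.pi_pos.le, Real.norm_of_nonneg (node_nonneg _ _), mul_one]
  have h1 : (1 : ℝ) ≤ node 1 n := by
    rw [node, Real.le_sqrt' one_pos]
    push_cast
    linarith [(Nat.cast_nonneg n : (0 : ℝ) ≤ n)]
  nlinarith [Real.two_le_pi, h1]

/-- **The expansion (3.3) is the generating function (1.6):** if
`F(τ,x) = ∑ₙ aₙ(x) q^{n+1} + τ ∑ₙ gₙ(x) q^{n+1}` then `F(τ,x) = genFun 1 a b τ x` with
`b = bOfG g`. [cite: CohnEtAl2019, §3.1 (3.3)] -/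
theorem genFun_eq_of_expansion {a g : ℕ → 𝓢(EuclideanSpace ℝ (Fin d), ℂ)}
    {F : ℍ → EuclideanSpace ℝ (Fin d) → ℂ}
    (hF : ∀ (τ : ℍ) (x : EuclideanSpace ℝ (Fin d)), F τ x = (∑' n : ℕ, a n x * Periodic.qParam 1 τ ^ (n + 1)) +
      (τ : ℂ) * ∑' n : ℕ, g n x * Periodic.qParam 1 τ ^ (n + 1)) (τ : ℍ) (x : EuclideanSpace ℝ (Fin d)) :
    genFun 1 (fun n => ⇑(a n)) (fun n => ⇑(bOfG g n)) τ x = F τ x := by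
  rw [hF, genFun_def]
  simp only [qParam_one_pow_succ, Nat.cast_one]
  congr 1
  rw [← tsum_mul_left]
  rw [← tsum_mul_left]
  congr 1
  funext n
  have h := node_mul_bOfG g n x
  calc 2 * π * Complex.I * (τ : ℂ) * ((node 1 n : ℂ) * bOfG g n x * cexp (2 * π * Complex.I * (1 + n) * τ))
      = (τ : ℂ) * ((2 * π * Complex.I * ((node 1 n : ℂ) * bOfG g n x)) *
          cexp (2 * π * Complex.I * (1 + n) * τ)) := by ring
    _ = (τ : ℂ) * (g n x * cexp (2 * π * Complex.I * (1 + n) * τ)) := by rw [h]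

/-! ## CKMRV Theorem 3.1 (`n₀ = 1`) -/

/-- **CKMRV Theorem 3.1** (functional equations ⇒ interpolation formula; `n₀ = 1`): "Suppose there
exist smooth functions `F, F̃ : ℍ × ℝᵈ → ℂ` such that (1) `F(τ,x)` and `F̃(τ,x)` are holomorphic
in `τ`, (2) radial in `x`, (3) `|x|ᵏ |D_x^ℓ F(τ,x)|, |x|ᵏ |D_x^ℓ F̃(τ,x)| < α Im(τ)^{−β} + γ|τ|^δ`,
(4) `|F(τ,x)|, |F̃(τ,x)| ≤ α₀₀ Im(τ)^{−β₀₀}` for `−1 ≤ Re τ ≤ 1` with `β₀₀ > 0`, and (5)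
`F(τ+2,x) − 2F(τ+1,x) + F(τ,x) = 0`, `F̃(τ+2,x) − 2F̃(τ+1,x) + F̃(τ,x) = 0`,
`F(τ,x) + (i/τ)^{d/2} F̃(−1/τ,x) = e^{πiτ|x|²}`. Then `F` and `F̃` have expansions of the form
(3.1)–(3.2) with `n₀ = 1`, for some radial Schwartz functions `aₙ, bₙ, ãₙ, b̃ₙ`. Moreover, for
every radial Schwartz `f`, the interpolation formula (1.4) (with `n₀ = 1`) holds, and the right
side converges absolutely." Here (3) is taken in Fréchet form (`IsGeneratingFamily`,
`HasGrowthBounds`); the conclusion is an `IsInterpolationBasis` whose generating functions are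
`F` and `F̃`. [cite: CohnEtAl2019, §3.1 Theorem 3.1] -/
theorem isInterpolationBasis_of_generatingFunctions [NeZero d] {F Ft : ℍ → EuclideanSpace ℝ (Fin d) → ℂ}
    (hF : IsGeneratingFamily F) (hFt : IsGeneratingFamily Ft)
    (hFrad : ∀ τ, IsRadial (F τ)) (hFtrad : ∀ τ, IsRadial (Ft τ))
    (hFE : ∀ (τ : ℍ) (x : EuclideanSpace ℝ (Fin d)), F τ x + (Complex.I / (τ : ℂ)) ^ ((d : ℂ) / 2) *
      Ft (UpperHalfPlane.negInv τ) x = cexp (π * Complex.I * (τ : ℂ) * ‖x‖ ^ 2)) :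
    ∃ a b a' b' : ℕ → 𝓢(EuclideanSpace ℝ (Fin d), ℂ), IsInterpolationBasis d 1 a b a' b' ∧
      (∀ (τ : ℍ) (x : EuclideanSpace ℝ (Fin d)), genFun 1 (fun n => ⇑(a n)) (fun n => ⇑(b n)) τ x = F τ x) ∧
      (∀ (τ : ℍ) (x : EuclideanSpace ℝ (Fin d)), genFun 1 (fun n => ⇑(a' n)) (fun n => ⇑(b' n)) τ x = Ft τ x) := by
  obtain ⟨α, β, hβ, h4⟩ := hF.strip
  obtain ⟨αt, βt, hβt, h4t⟩ := hFt.strip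
  obtain ⟨a, g, -, -, -, -, hexp, hgrowth, hrad⟩ := exists_schwartz_coefficients hF.smooth hF.cont hF.hol
    hF.shift_sq hF.growth hβ h4
  obtain ⟨a', g', -, -, -, -, hexp', hgrowth', hrad'⟩ := exists_schwartz_coefficients hFt.smooth hFt.cont
    hFt.hol hFt.shift_sq hFt.growth hβt h4t
  have hgen : ∀ (τ : ℍ) (x : EuclideanSpace ℝ (Fin d)),
      genFun 1 (fun n => ⇑(a n)) (fun n => ⇑(bOfG g n)) τ x = F τ x :=
    genFun_eq_of_expansion hexp
  have hgen' : ∀ (τ : ℍ) (x : EuclideanSpace ℝ (Fin d)),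
      genFun 1 (fun n => ⇑(a' n)) (fun n => ⇑(bOfG g' n)) τ x = Ft τ x :=
    genFun_eq_of_expansion hexp'
  refine ⟨a, bOfG g, a', bOfG g', ?_, hgen, hgen'⟩
  refine IsInterpolationBasis.of_functionalEquation le_rfl (fun n => (hrad hFrad n).1)
    (fun n => isRadial_bOfG (fun n => (hrad hFrad n).2) n) (fun n => (hrad' hFtrad n).1)
    (fun n => isRadial_bOfG (fun n => (hrad' hFtrad n).2) n) (fun x => ?_) (fun τ x => ?_)
  · obtain ⟨C, N, hCN⟩ := hgrowth x
    obtain ⟨C', N', hCN'⟩ := hgrowth' x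
    have hC : 0 ≤ C := le_trans (norm_nonneg _) (by simpa using (hCN 0).1)
    have hC' : 0 ≤ C' := le_trans (norm_nonneg _) (by simpa using (hCN' 0).1)
    refine ⟨C + C', N + N', fun n => ?_⟩
    have h1 : ∀ n : ℕ, C * (1 + (n : ℝ)) ^ N ≤ (C + C') * (1 + n) ^ (N + N') := fun n =>
      mul_le_mul (by linarith) (pow_le_pow_right₀ (by linarith [(Nat.cast_nonneg n : (0:ℝ) ≤ n)])
        (by omega)) (by positivity) (by positivity)
    have h2 : ∀ n : ℕ, C' * (1 + (n : ℝ)) ^ N' ≤ (C + C') * (1 + n) ^ (N + N') := fun n =>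
      mul_le_mul (by linarith) (pow_le_pow_right₀ (by linarith [(Nat.cast_nonneg n : (0:ℝ) ≤ n)])
        (by omega)) (by positivity) (by positivity)
    exact ⟨(hCN n).1.trans (h1 n), ((norm_bOfG_le g n x).trans (hCN n).2).trans (h1 n),
      (hCN' n).1.trans (h2 n), ((norm_bOfG_le g' n x).trans (hCN' n).2).trans (h2 n)⟩
  · have h := hFE τ x
    rw [← hgen τ x, ← hgen' (UpperHalfPlane.negInv τ) x, UpperHalfPlane.coe_negInv] at h
    exact h

end Literature.Analysis.Fourier
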